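import Mathlib
import HarnessLib
import Summits.ResolutionOfSingularities.ResolutionOfSingularities.Theorems.WildQuotientsWildQuotientResolutionS1aMemberAwaySections2

/-!
# S1a — R4c cusp, brick (b3′-relations): RELATIONS OF THE MEMBER SECTIONS WITH RESTRICTED SECTIONS OF THE PRODUCER CHART (`memberSection_relation`)

[OURS · L1 W4.5c · lead-1 g17; plan-1 RULING R-F15v (2) ★ R4c `cusp_killsIn_two`, memo `Cruxes/CyclicQuotientFourfolds/Lines/s1a_logminvertex-R4c-PROGRESS.md` §2/§4:
✓`exists_memberSections_away₂` exports the VALUES of the member sections `a, b` in the localised model (`a·u₀^{e₀} = x′₀/1`, …); ✓`killsIn_one_of_sectionCharts` needs their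
RELATIONS `a·R = glob|_U` with honest sections `R`. This file (abstract over the node data `DW`, so it elaborates fast): from the second pin of the localised model
(`hpin2` of ✓`FreeModel.exists_awayModelEquiv`: `Φ x = a/1 ⇒ Φ′(x/1) = a/1`), the values of sections of the producer chart restricted to `D(b)` are computed
(`coe_restrict_eq`: ✓`NodeChartAway.coe_basicOpenNodeEquiv_map` + ✓`coe_zeroRingEquiv`), whence `s·(r|_{D(b)})^e = r′|_{D(b)}` from a polynomial identity
(`memberSection_relation`; on `U_O`: `a·(π^*x₂)³ = π^*x₀`, `b·(π^*x₁)³ = π^*f`)] — NOT statements of the manuscript; counted 0; AI-level work, weaker than expert review.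
Crux stmt-ResolutionOfSingularities-17941 `CyclicQuotientFourfolds`, line `s1a-logminvertex` v13 (`stub_reachLowerInFX`).
-/

set_option linter.dupNamespace false

noncomputable section

open CategoryTheory Limits AlgebraicGeometry TopologicalSpace Topology Opposite MvPolynomial
open Literature.AlgebraicGeometry.Resolution Literature.AlgebraicGeometry.RelativeSpec
open scoped LaurentPolynomial
open Summit.ResolutionOfSingularities.ResolutionOfSingularities.Theorems.WildQuotientResolution.S1
open Summit.ResolutionOfSingularities.ResolutionOfSingularities.Theorems.WildQuotientResolution.S1.NodeAtlas
open Summit.ResolutionOfSingularities.ResolutionOfSingularities.Theorems.WildQuotientResolution.S1.ProducerStep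
open Summit.ResolutionOfSingularities.ResolutionOfSingularities.Theorems.WildQuotientResolution.S1.CoarseChart
open Summit.ResolutionOfSingularities.ResolutionOfSingularities.Theorems.WildQuotientResolution.S1.NodeTransport
open Summit.ResolutionOfSingularities.ResolutionOfSingularities.Theorems.WildQuotientResolution.S1.KillCert
open Summit.ResolutionOfSingularities.ResolutionOfSingularities.Theorems.WildQuotientResolution.S1.BlowupCharts
open Summit.ResolutionOfSingularities.ResolutionOfSingularities.Theorems.WildQuotientResolution.S1.NpFrame
open Summit.ResolutionOfSingularities.ResolutionOfSingularities.Theorems.WildQuotientResolution.S1.NodeAway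
open Summit.ResolutionOfSingularities.ResolutionOfSingularities.Theorems.WildQuotientResolution.S1.FreeModel
open Summit.ResolutionOfSingularities.ResolutionOfSingularities.Theorems.WildQuotientResolution.S1.GoodCharts
open Summit.ResolutionOfSingularities.ResolutionOfSingularities.Theorems.WildQuotientResolution.S1.GameFrame.GModel

namespace Summit.ResolutionOfSingularities.ResolutionOfSingularities.Theorems.WildQuotientResolution.S1.GameFrame.GModel

variable {p : ℕ} {X' X₁ : Scheme.{0}} {q : X' ⟶ X₁} {G : Type} [Group G] {ρ : G →* Aut X'} {g₀ : G}

section MemberAway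

variable {k : Type} [Field k] (hG : ∀ g : G, g ∈ Subgroup.zpowers g₀) (M : GModel p q G ρ g₀) (W : M.act.StableAffineOpens) (DW : NodeData p M.act g₀ W)
  (qd b' : (MvPolynomial (Option (Fin 4)) k)) (Φ : letI := DW.instCommRing; letI := DW.instGradedRing; DW.B ≃+* Localization.Away qd) (b : Γ(M.V, W.1))
  (hσb : letI := DW.instCommRing; letI := DW.instGradedRing; DW.σ ((DW.e b : ↥(DW.𝒜 0)) : DW.B) = ((DW.e b : ↥(DW.𝒜 0)) : DW.B))
  (Φ' : letI := DW.instCommRing; letI := DW.instGradedRing; (Localization.Away ((DW.e b : ↥(DW.𝒜 0)) : DW.B)) ≃+* Localization.Away (qd * b'))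
  (hpin : letI := DW.instCommRing; letI := DW.instGradedRing; ∀ a : (MvPolynomial (Option (Fin 4)) k), Φ' (algebraMap DW.B (Localization.Away ((DW.e b : ↥(DW.𝒜 0)) : DW.B)) (Φ.symm ((algebraMap (MvPolynomial (Option (Fin 4)) k) (Localization.Away qd)) a))) = (algebraMap (MvPolynomial (Option (Fin 4)) k) (Localization.Away (qd * b'))) a)

set_option maxHeartbeats 4000000 in
set_option synthInstance.maxHeartbeats 400000 in
/-- **Values of restricted producer sections in the localised model**: if `Φ(DW.e r) = P_r/1` then the image of `r|_{D(b)}` under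
`(e_{D(b)} ≫ zeroRingEquiv)` is `P_r/1` in `k[s,x′][1/(q b′)]`. [OURS · L1 W4.5c · R4c] -/
theorem coe_restrict_eq
    (hpin2 : letI := DW.instCommRing; letI := DW.instGradedRing; ∀ (x : DW.B) (a : (MvPolynomial (Option (Fin 4)) k)), Φ x = (algebraMap (MvPolynomial (Option (Fin 4)) k) (Localization.Away qd)) a → Φ' (algebraMap DW.B (Localization.Away ((DW.e b : ↥(DW.𝒜 0)) : DW.B)) x) = (algebraMap (MvPolynomial (Option (Fin 4)) k) (Localization.Away (qd * b'))) a)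
    (r : Γ(M.V, W.1)) (Pr : (MvPolynomial (Option (Fin 4)) k)) (hr : letI := DW.instCommRing; letI := DW.instGradedRing; Φ ((DW.e r : ↥(DW.𝒜 0)) : DW.B) = (algebraMap (MvPolynomial (Option (Fin 4)) k) (Localization.Away qd)) Pr) :
    letI := DW.instCommRing; letI := DW.instGradedRing
    letI := GradedLocalization.locGradedRing DW.𝒜 (DW.e b).2
    letI := mapGradedRing (GradedLocalization.locPiece DW.𝒜 (DW.e b).2) Φ'
    ((((NodeChartAway.basicOpenNodeEquiv M.act W DW.affine b DW.𝒜 DW.e).trans (zeroRingEquiv (GradedLocalization.locPiece DW.𝒜 (DW.e b).2) Φ')) ((M.V.presheaf.map (homOfLE (M.V.basicOpen_le b)).op).hom r) :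
        ↥(mapGrading (GradedLocalization.locPiece DW.𝒜 (DW.e b).2) Φ' 0)) : Localization.Away (qd * b')) = (algebraMap (MvPolynomial (Option (Fin 4)) k) (Localization.Away (qd * b'))) Pr := by
  letI := DW.instCommRing
  letI := DW.instGradedRing
  letI instL := GradedLocalization.locGradedRing DW.𝒜 (DW.e b).2
  letI instP := mapGradedRing (GradedLocalization.locPiece DW.𝒜 (DW.e b).2) Φ'
  rw [RingEquiv.trans_apply, coe_zeroRingEquiv]
  change Φ' (((NodeChartAway.basicOpenNodeEquiv M.act W DW.affine b DW.𝒜 DW.e) (algebraMap Γ(M.V, W.1) Γ(M.V, M.V.basicOpen b) r) : ↥((GradedLocalization.locPiece DW.𝒜 (DW.e b).2) 0)) : (Localization.Away ((DW.e b : ↥(DW.𝒜 0)) : DW.B))) = _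
  rw [NodeChartAway.coe_basicOpenNodeEquiv_map]
  exact hpin2 _ _ hr

set_option maxHeartbeats 4000000 in
set_option synthInstance.maxHeartbeats 400000 in
/-- ★ **Relation of a member section with restricted producer sections**: if `s·u^e = P/1` in the localised model (the form exported by
✓`exists_memberSections_away₂`), `Φ(DW.e r) = P_r/1`, `Φ(DW.e r′) = P_{r′}/1` and `P_r^e = u^e·m`, `P_{r′} = P·m` for a polynomial `m`, then
`s·(r|_{D(b)})^e = r′|_{D(b)}` in `Γ(D(b))`. [OURS · L1 W4.5c · R4c] -/
theorem memberSection_relation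
    (hpin2 : letI := DW.instCommRing; letI := DW.instGradedRing; ∀ (x : DW.B) (a : (MvPolynomial (Option (Fin 4)) k)), Φ x = (algebraMap (MvPolynomial (Option (Fin 4)) k) (Localization.Away qd)) a → Φ' (algebraMap DW.B (Localization.Away ((DW.e b : ↥(DW.𝒜 0)) : DW.B)) x) = (algebraMap (MvPolynomial (Option (Fin 4)) k) (Localization.Away (qd * b'))) a)
    (s : Γ(M.V, M.V.basicOpen b)) (u P : (MvPolynomial (Option (Fin 4)) k)) (e : ℕ)
    (hs : letI := DW.instCommRing; letI := DW.instGradedRing; letI := GradedLocalization.locGradedRing DW.𝒜 (DW.e b).2; letI := mapGradedRing (GradedLocalization.locPiece DW.𝒜 (DW.e b).2) Φ'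
      ((((NodeChartAway.basicOpenNodeEquiv M.act W DW.affine b DW.𝒜 DW.e).trans (zeroRingEquiv (GradedLocalization.locPiece DW.𝒜 (DW.e b).2) Φ')) s : ↥(mapGrading (GradedLocalization.locPiece DW.𝒜 (DW.e b).2) Φ' 0)) : Localization.Away (qd * b')) * (algebraMap (MvPolynomial (Option (Fin 4)) k) (Localization.Away (qd * b'))) u ^ e = (algebraMap (MvPolynomial (Option (Fin 4)) k) (Localization.Away (qd * b'))) P)
    (r r' : Γ(M.V, W.1)) (Pr Pr' m : (MvPolynomial (Option (Fin 4)) k))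
    (hr : letI := DW.instCommRing; letI := DW.instGradedRing; Φ ((DW.e r : ↥(DW.𝒜 0)) : DW.B) = (algebraMap (MvPolynomial (Option (Fin 4)) k) (Localization.Away qd)) Pr) (hr' : letI := DW.instCommRing; letI := DW.instGradedRing; Φ ((DW.e r' : ↥(DW.𝒜 0)) : DW.B) = (algebraMap (MvPolynomial (Option (Fin 4)) k) (Localization.Away qd)) Pr')
    (hid : Pr ^ e = u ^ e * m) (hid' : Pr' = P * m) :
    s * (M.V.presheaf.map (homOfLE (M.V.basicOpen_le b)).op).hom r ^ e =
      (M.V.presheaf.map (homOfLE (M.V.basicOpen_le b)).op).hom r' := by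
  letI := DW.instCommRing
  letI := DW.instGradedRing
  letI instL := GradedLocalization.locGradedRing DW.𝒜 (DW.e b).2
  letI instP := mapGradedRing (GradedLocalization.locPiece DW.𝒜 (DW.e b).2) Φ'
  have h1 := coe_restrict_eq M W DW qd b' Φ b Φ' hpin2 r Pr hr
  have h2 := coe_restrict_eq M W DW qd b' Φ b Φ' hpin2 r' Pr' hr'
  apply ((NodeChartAway.basicOpenNodeEquiv M.act W DW.affine b DW.𝒜 DW.e).trans (zeroRingEquiv (GradedLocalization.locPiece DW.𝒜 (DW.e b).2) Φ')).injective
  apply Subtype.ext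
  rw [map_mul, map_pow, SetLike.GradeZero.coe_mul, SetLike.GradeZero.coe_pow, h1, h2, ← map_pow, hid, hid', map_mul, map_mul, map_pow, ← hs]
  ring

end MemberAway

end Summit.ResolutionOfSingularities.ResolutionOfSingularities.Theorems.WildQuotientResolution.S1.GameFrame.GModel

end
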